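import Mathlib
import HarnessLib
import Literature.MathematicalPhysics.QuantumManyBody.BoseEinsteinCondensation
import Literature.MathematicalPhysics.QuantumManyBody.BoseGasFreeDirichletBEC
import Literature.MathematicalPhysics.QuantumManyBody.BoseGasDirichletWall
import Literature.MathematicalPhysics.QuantumManyBody.OneParticleMarginals

/-!
# Route GapWindowLadder — analytic toolkit for the support item `MixingTransfer`

decomp-a2c lens-6 g13. The Dirichlet-box twins of the folklore identities behind every convexity /
mixing argument for the Bose gas in `Literature/…/BoseEinsteinCondensation.lean` currency:

* the PARALLELOGRAM and SCALING laws for the raw energy form `q_v(χ) = ∫ |∇χ|² + V|χ|²`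
  (`energyForm_add_add_sub`, `energyForm_const_mul`), for the `L²` mass (`mass_add_add_sub`,
  `mass_const_mul`, and the Young bound `two_mul_mass_le : 2‖φ ± ψ‖² ≤ (8/3)‖φ‖² + 8‖ψ‖²`), and for the
  level-`k` pair-loss functional `16⁻¹ Σ_{c ~ c'} ⟨u_c − u_{c'}, γ (u_c − u_{c'})⟩` in superpositions of two
  trial states (`pairLoss_add_add_sub`, `pairLoss_const_mul`);
* the NORMALISING CONSTRUCTOR `exists_trialState_const_mul` (an admissible raw function of finite non-zero
  mass is a multiple of a trial state) and the variational bound `groundStateEnergy_mul_mass_le :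
  E₀ · ‖U‖² ≤ q_v(U)`.

Everything is stated over the Literature declarations only (measurable `v`, any box); the proofs re-derive
privately the pointwise lemmas of `Literature/…/PeriodicClusteringFromKyFanGap.lean` and
`CondensateOccupationStability.lean` so that this file imports Literature modules only (no route file: theses-cone clean).
Consumed by `Theorems/GapWindowLadderMixingTransfer.lean`.
-/

noncomputable section

namespace Summit.AtomisticToContinuum.BoseEinsteinCondensation.Theorems.GapWindowLadderMixingTransferAux

open scoped BigOperators ENNReal NNReal ComplexConjugate
open Filter MeasureTheory
open Literature.MathematicalPhysics.QuantumManyBody.BoseGas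
variable {n N : ℕ} {L : ℝ} {v : ℝ → ℝ≥0∞}

/-! ## Dirichlet energy form, `L²` mass: parallelogram, scaling, Young -/

/-- the parallelogram law in `ℂ`, read in `ℝ≥0∞`. -/
private theorem mt_sq_nnnorm_add_add_sub (a b : ℂ) :
    ((‖a + b‖₊ : ℝ≥0∞)) ^ 2 + ((‖a - b‖₊ : ℝ≥0∞)) ^ 2 =
      2 * (((‖a‖₊ : ℝ≥0∞)) ^ 2 + ((‖b‖₊ : ℝ≥0∞)) ^ 2) := by
  have h := congrArg (fun r : ℝ≥0 => (r : ℝ≥0∞)) (parallelogram_law_with_nnnorm ℂ a b)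
  push_cast at h
  exact h

/-- parallelogram law for the kinetic density (differentiable `φ, ψ`). -/
private theorem mt_kineticDensity_add_add_sub {φ ψ : Config N → ℂ} (hφ : Differentiable ℝ φ)
    (hψ : Differentiable ℝ ψ) (X : Config N) :
    kineticDensity (fun Y => φ Y + ψ Y) X + kineticDensity (fun Y => φ Y - ψ Y) X =
      2 * (kineticDensity φ X + kineticDensity ψ X) := by
  unfold kineticDensity
  have h1 : fderiv ℝ (fun Y => φ Y + ψ Y) X = fderiv ℝ φ X + fderiv ℝ ψ X :=
    fderiv_fun_add (hφ X) (hψ X)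
  have h2 : fderiv ℝ (fun Y => φ Y - ψ Y) X = fderiv ℝ φ X - fderiv ℝ ψ X :=
    fderiv_fun_sub (hφ X) (hψ X)
  rw [h1, h2]
  simp only [FunLike.coe_add, FunLike.coe_sub, Pi.add_apply, Pi.sub_apply,
    mul_add, Finset.mul_sum, ← Finset.sum_add_distrib]
  refine Finset.sum_congr rfl fun i _ => Finset.sum_congr rfl fun k _ => ?_
  rw [mt_sq_nnnorm_add_add_sub, mul_add]

/-- scaling law for the kinetic density. -/
private theorem mt_kineticDensity_const_mul (c : ℂ) {ψ : Config N → ℂ} (hψ : Differentiable ℝ ψ)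
    (X : Config N) :
    kineticDensity (fun Y => c * ψ Y) X = ((‖c‖₊ : ℝ≥0∞)) ^ 2 * kineticDensity ψ X := by
  unfold kineticDensity
  have h : fderiv ℝ (fun Y => c * ψ Y) X = c • fderiv ℝ ψ X := fderiv_fun_const_smul (hψ X) c
  rw [h]
  simp only [FunLike.coe_smul, Pi.smul_apply, smul_eq_mul, Finset.mul_sum]
  refine Finset.sum_congr rfl fun i _ => Finset.sum_congr rfl fun k _ => ?_
  rw [nnnorm_mul, ENNReal.coe_mul, mul_pow]

/-- homogeneity of mode occupations: `⟨φ, γ_{cΨ} φ⟩ = |c|² ⟨φ, γ_Ψ φ⟩`. -/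
private theorem mt_occupation_const_mul (N : ℕ) (φ : Space → ℂ) (c : ℂ) (Ψ : Config N → ℂ) :
    occupation N φ (fun X => c * Ψ X) = ((‖c‖₊ : ℝ≥0∞)) ^ 2 * occupation N φ Ψ := by
  cases N with
  | zero => simp [occupation]
  | succ n =>
    simp only [occupation]
    have h : ∀ Y : Config n, (∫ x, conj (φ x) * (c * Ψ (Matrix.vecCons x Y))) =
        c * ∫ x, conj (φ x) * Ψ (Matrix.vecCons x Y) := fun Y => by
      rw [← integral_const_mul]
      congr 1
      funext x
      ring
    simp only [h, nnnorm_mul, ENNReal.coe_mul, mul_pow]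
    rw [lintegral_const_mul' _ _ (ENNReal.pow_ne_top ENNReal.coe_ne_top)]
    ring

/-- the Dirichlet energy integrand of a continuous function is measurable (measurable `v`). -/
private theorem mt_measurable_integrand (hv : Measurable v) {χ : Config N → ℂ} (hχ : Continuous χ) :
    Measurable fun X => kineticDensity χ X + interaction v X * ((‖χ X‖₊ : ℝ≥0∞)) ^ 2 :=
  (measurable_kineticDensity_any χ).add ((measurable_interaction hv).mul (measurable_normSq hχ))

/-- parallelogram law for the Dirichlet energy form `q(χ) = ∫ |∇χ|² + V|χ|²`. -/
theorem energyForm_add_add_sub (hv : Measurable v) {φ ψ : Config N → ℂ}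
    (hφ : ContDiff ℝ 1 φ) (hψ : ContDiff ℝ 1 ψ) :
    (∫⁻ X, kineticDensity (fun Y => φ Y + ψ Y) X +
        interaction v X * ((‖φ X + ψ X‖₊ : ℝ≥0∞)) ^ 2) +
    (∫⁻ X, kineticDensity (fun Y => φ Y - ψ Y) X +
        interaction v X * ((‖φ X - ψ X‖₊ : ℝ≥0∞)) ^ 2) =
    2 * (∫⁻ X, kineticDensity φ X + interaction v X * ((‖φ X‖₊ : ℝ≥0∞)) ^ 2) +
    2 * (∫⁻ X, kineticDensity ψ X + interaction v X * ((‖ψ X‖₊ : ℝ≥0∞)) ^ 2) := by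
  have hA := mt_measurable_integrand hv (χ := fun Y => φ Y + ψ Y)
    (hφ.continuous.add hψ.continuous)
  have hC := mt_measurable_integrand hv hφ.continuous
  have hD := mt_measurable_integrand hv hψ.continuous
  rw [← lintegral_add_left hA, ← lintegral_const_mul _ hC, ← lintegral_const_mul _ hD,
    ← lintegral_add_left (hC.const_mul 2)]
  refine lintegral_congr fun X => ?_
  have hk := mt_kineticDensity_add_add_sub (hφ.differentiable one_ne_zero)
    (hψ.differentiable one_ne_zero) X
  have hn := mt_sq_nnnorm_add_add_sub (φ X) (ψ X)
  calc _ = (kineticDensity (fun Y => φ Y + ψ Y) X + kineticDensity (fun Y => φ Y - ψ Y) X) +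
        interaction v X *
          (((‖φ X + ψ X‖₊ : ℝ≥0∞)) ^ 2 + ((‖φ X - ψ X‖₊ : ℝ≥0∞)) ^ 2) := by ring
    _ = 2 * (kineticDensity φ X + kineticDensity ψ X) + interaction v X *
          (2 * (((‖φ X‖₊ : ℝ≥0∞)) ^ 2 + ((‖ψ X‖₊ : ℝ≥0∞)) ^ 2)) := by rw [hk, hn]
    _ = _ := by ring

/-- scaling law for the Dirichlet energy form: `q(cψ) = |c|² q(ψ)`. -/
theorem energyForm_const_mul (v : ℝ → ℝ≥0∞) (c : ℂ) {ψ : Config N → ℂ}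
    (hψ : ContDiff ℝ 1 ψ) :
    ∫⁻ X, kineticDensity (fun Y => c * ψ Y) X +
        interaction v X * ((‖c * ψ X‖₊ : ℝ≥0∞)) ^ 2 =
      ((‖c‖₊ : ℝ≥0∞)) ^ 2 * ∫⁻ X, kineticDensity ψ X +
        interaction v X * ((‖ψ X‖₊ : ℝ≥0∞)) ^ 2 := by
  rw [← lintegral_const_mul' _ _ (ENNReal.pow_ne_top ENNReal.coe_ne_top)]
  refine lintegral_congr fun X => ?_
  rw [mt_kineticDensity_const_mul c (hψ.differentiable one_ne_zero) X, nnnorm_mul, ENNReal.coe_mul,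
    mul_pow]
  ring

/-- scaling of the `L²` mass: `‖cψ‖² = |c|²‖ψ‖²`. -/
theorem mass_const_mul (c : ℂ) (ψ : Config N → ℂ) :
    ∫⁻ X, ((‖c * ψ X‖₊ : ℝ≥0∞)) ^ 2 = ((‖c‖₊ : ℝ≥0∞)) ^ 2 * ∫⁻ X, ((‖ψ X‖₊ : ℝ≥0∞)) ^ 2 := by
  rw [← lintegral_const_mul' _ _ (ENNReal.pow_ne_top ENNReal.coe_ne_top)]
  refine lintegral_congr fun X => ?_
  rw [nnnorm_mul, ENNReal.coe_mul, mul_pow]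

/-- parallelogram law for the `L²` mass. -/
theorem mass_add_add_sub {φ ψ : Config N → ℂ} (hφ : Continuous φ)
    (hψ : Continuous ψ) :
    (∫⁻ X, ((‖φ X + ψ X‖₊ : ℝ≥0∞)) ^ 2) + (∫⁻ X, ((‖φ X - ψ X‖₊ : ℝ≥0∞)) ^ 2) =
    2 * (∫⁻ X, ((‖φ X‖₊ : ℝ≥0∞)) ^ 2) + 2 * (∫⁻ X, ((‖ψ X‖₊ : ℝ≥0∞)) ^ 2) := by
  rw [← lintegral_add_left (measurable_normSq (ψ := fun Y => φ Y + ψ Y) (hφ.add hψ)),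
    ← lintegral_const_mul _ (measurable_normSq hφ),
    ← lintegral_const_mul _ (measurable_normSq hψ),
    ← lintegral_add_left ((measurable_normSq hφ).const_mul 2)]
  exact lintegral_congr fun X => by rw [mt_sq_nnnorm_add_add_sub, mul_add]

/-- Young: `2|a + b|² ≤ (8/3)|a|² + 8|b|²` in `ℝ≥0∞`. -/
private theorem mt_two_mul_sq_nnnorm_add_le (a b : ℂ) :
    2 * ((‖a + b‖₊ : ℝ≥0∞)) ^ 2 ≤
      ENNReal.ofReal (8 / 3) * ((‖a‖₊ : ℝ≥0∞)) ^ 2 + ENNReal.ofReal 8 * ((‖b‖₊ : ℝ≥0∞)) ^ 2 := by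
  have h : 2 * ‖a + b‖ ^ 2 ≤ 8 / 3 * ‖a‖ ^ 2 + 8 * ‖b‖ ^ 2 := by
    have h1 := norm_add_le a b
    have h2 : 0 ≤ ‖a + b‖ := norm_nonneg _
    nlinarith [sq_nonneg (‖a‖ - 3 * ‖b‖), norm_nonneg a, norm_nonneg b, mul_nonneg h2 h2]
  simp only [coe_nnnorm_sq_eq_ofReal]
  rw [← ENNReal.ofReal_ofNat 2, ← ENNReal.ofReal_mul (by norm_num), ← ENNReal.ofReal_mul (by norm_num),
    ← ENNReal.ofReal_mul (by norm_num), ← ENNReal.ofReal_add (by positivity) (by positivity)]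
  exact ENNReal.ofReal_le_ofReal h

/-- Young: `2|a − b|² ≤ (8/3)|a|² + 8|b|²` in `ℝ≥0∞`. -/
private theorem mt_two_mul_sq_nnnorm_sub_le (a b : ℂ) :
    2 * ((‖a - b‖₊ : ℝ≥0∞)) ^ 2 ≤
      ENNReal.ofReal (8 / 3) * ((‖a‖₊ : ℝ≥0∞)) ^ 2 + ENNReal.ofReal 8 * ((‖b‖₊ : ℝ≥0∞)) ^ 2 := by
  simpa only [sub_eq_add_neg, nnnorm_neg] using mt_two_mul_sq_nnnorm_add_le a (-b)

/-- Young for the `L²` masses of `φ ± ψ`. -/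
theorem two_mul_mass_le {φ ψ : Config N → ℂ} (hφ : Continuous φ) (hψ : Continuous ψ) :
    2 * (∫⁻ X, ((‖φ X + ψ X‖₊ : ℝ≥0∞)) ^ 2) ≤
      ENNReal.ofReal (8 / 3) * (∫⁻ X, ((‖φ X‖₊ : ℝ≥0∞)) ^ 2) +
        ENNReal.ofReal 8 * (∫⁻ X, ((‖ψ X‖₊ : ℝ≥0∞)) ^ 2) ∧
    2 * (∫⁻ X, ((‖φ X - ψ X‖₊ : ℝ≥0∞)) ^ 2) ≤
      ENNReal.ofReal (8 / 3) * (∫⁻ X, ((‖φ X‖₊ : ℝ≥0∞)) ^ 2) +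
        ENNReal.ofReal 8 * (∫⁻ X, ((‖ψ X‖₊ : ℝ≥0∞)) ^ 2) := by
  rw [← lintegral_const_mul _ (measurable_normSq (ψ := fun Y => φ Y + ψ Y) (hφ.add hψ)),
    ← lintegral_const_mul _ (measurable_normSq (ψ := fun Y => φ Y - ψ Y) (hφ.sub hψ)),
    ← lintegral_const_mul _ (measurable_normSq hφ),
    ← lintegral_const_mul _ (measurable_normSq hψ),
    ← lintegral_add_left ((measurable_normSq hφ).const_mul _)]
  exact ⟨lintegral_mono fun X => mt_two_mul_sq_nnnorm_add_le (φ X) (ψ X),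
    lintegral_mono fun X => mt_two_mul_sq_nnnorm_sub_le (φ X) (ψ X)⟩

/-! ## Normalisation and the variational lower bound `E₀‖U‖² ≤ q(U)` -/

/-- normalising constructor: an admissible `u` with `0 < ‖u‖² < ∞` is `a⁻¹ Ψ` for a Dirichlet trial state. -/
theorem exists_trialState_const_mul {u : Config N → ℂ} (hu : ContDiff ℝ 1 u)
    (h0u : ∀ X, X ∉ boxN N L → u X = 0)
    (hsymm : ∀ (σ : Equiv.Perm (Fin N)) (X : Config N), u (X ∘ σ) = u X)
    (h0 : ∫⁻ X, ((‖u X‖₊ : ℝ≥0∞)) ^ 2 ≠ 0) (htop : ∫⁻ X, ((‖u X‖₊ : ℝ≥0∞)) ^ 2 ≠ ⊤) :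
    ∃ (Ψ : TrialState N L) (a : ℝ), (Ψ.ψ = fun X => (a : ℂ) * u X) ∧
      ((‖(a : ℂ)‖₊ : ℝ≥0∞)) ^ 2 = (∫⁻ X, ((‖u X‖₊ : ℝ≥0∞)) ^ 2)⁻¹ := by
  set I := ∫⁻ X, ((‖u X‖₊ : ℝ≥0∞)) ^ 2 with hI
  have hIpos : 0 < I.toReal := ENNReal.toReal_pos h0 htop
  set a : ℝ := (Real.sqrt I.toReal)⁻¹ with ha_def
  have ha : ((‖(a : ℂ)‖₊ : ℝ≥0∞)) ^ 2 = I⁻¹ := by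
    rw [coe_nnnorm_sq_eq_ofReal, Complex.norm_real, Real.norm_of_nonneg (by positivity), ha_def,
      inv_pow, Real.sq_sqrt hIpos.le, ENNReal.ofReal_inv_of_pos hIpos, ENNReal.ofReal_toReal htop]
  refine ⟨⟨fun X => (a : ℂ) * u X, contDiff_const.mul hu,
    fun X hX => by simp only [h0u X hX, mul_zero], fun σ X => by simp only [hsymm], ?_⟩,
    a, rfl, ha⟩
  rw [mass_const_mul, ha, ENNReal.inv_mul_cancel h0 htop]

/-- the variational lower bound for raw admissible functions: `E₀ · ‖U‖² ≤ q(U)`. -/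
theorem groundStateEnergy_mul_mass_le (v : ℝ → ℝ≥0∞) {U : Config N → ℂ} (hU : ContDiff ℝ 1 U)
    (h0U : ∀ X, X ∉ boxN N L → U X = 0)
    (hsy : ∀ (σ : Equiv.Perm (Fin N)) (X : Config N), U (X ∘ σ) = U X)
    (htop : ∫⁻ X, ((‖U X‖₊ : ℝ≥0∞)) ^ 2 ≠ ⊤) :
    groundStateEnergy v N L * (∫⁻ X, ((‖U X‖₊ : ℝ≥0∞)) ^ 2) ≤
      ∫⁻ X, kineticDensity U X + interaction v X * ((‖U X‖₊ : ℝ≥0∞)) ^ 2 := by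
  by_cases h0 : ∫⁻ X, ((‖U X‖₊ : ℝ≥0∞)) ^ 2 = 0
  · rw [h0, mul_zero]; exact bot_le
  obtain ⟨Ψ, a, hΨ, ha⟩ := exists_trialState_const_mul hU h0U hsy h0 htop
  have hE : energy v Ψ = (∫⁻ X, ((‖U X‖₊ : ℝ≥0∞)) ^ 2)⁻¹ *
      ∫⁻ X, kineticDensity U X + interaction v X * ((‖U X‖₊ : ℝ≥0∞)) ^ 2 := by
    unfold energy
    rw [hΨ, energyForm_const_mul v (a : ℂ) hU, ha]
  calc _ ≤ energy v Ψ * (∫⁻ X, ((‖U X‖₊ : ℝ≥0∞)) ^ 2) :=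
        mul_le_mul' (groundStateEnergy_le_energy v Ψ) le_rfl
    _ = _ := by rw [hE, mul_comm _⁻¹, mul_assoc, ENNReal.inv_mul_cancel h0 htop, mul_one]

/-! ## Mode occupations of superpositions: scaling and parallelogram -/

/-- slices of Dirichlet trial states are integrable. -/
private theorem mt_integrable_slice (Ψ : TrialState (n + 1) L) (Y : Config n) :
    Integrable fun x => Ψ.ψ (Matrix.vecCons x Y) := by
  have hc : Continuous fun x : Space => Ψ.ψ (Matrix.vecCons x Y) :=
    Ψ.contDiff.continuous.comp (continuous_id.matrixVecCons continuous_const)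
  refine hc.integrable_of_hasCompactSupport ?_
  have hbox : Bornology.IsBounded (box L) := by
    rw [isBounded_iff_forall_norm_le]
    refine ⟨Real.sqrt (3 * L ^ 2), fun x hx => ?_⟩
    rw [EuclideanSpace.norm_eq]
    apply Real.sqrt_le_sqrt
    have h : ∀ i, ‖x i‖ ^ 2 ≤ L ^ 2 := fun i => by
      obtain ⟨h1, h2⟩ := hx i
      rw [Real.norm_eq_abs, sq_abs]
      nlinarith
    calc ∑ i, ‖x i‖ ^ 2 ≤ ∑ _i : Fin 3, L ^ 2 := Finset.sum_le_sum fun i _ => h i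
      _ = 3 * L ^ 2 := by simp
  refine HasCompactSupport.intro hbox.isCompact_closure fun x hx => ?_
  refine Ψ.eq_zero _ fun hX => hx (subset_closure ?_)
  simpa using hX 0

/-- integrability of `conj(u) · (a Ψ(·, Y))` for a bounded measurable mode `u`. -/
private theorem mt_integrable_pairing {u : Space → ℂ} (hu : Measurable u) {C : ℝ}
    (hC : ∀ x, ‖u x‖ ≤ C) (Ψ : TrialState (n + 1) L) (Y : Config n) (a : ℂ) :
    Integrable fun x => conj (u x) * (a * Ψ.ψ (Matrix.vecCons x Y)) := by
  refine ((mt_integrable_slice Ψ Y).const_mul a).bdd_mul (c := C)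
    (Complex.continuous_conj.comp_aestronglyMeasurable hu.aestronglyMeasurable)
    (Filter.Eventually.of_forall fun x => ?_)
  rw [Complex.norm_conj]
  exact hC x

/-- measurability of `Y ↦ |∫ conj(u) χ(·, Y)|²` for a measurable mode and a continuous `χ`. -/
private theorem mt_measurable_pairing_sq {u : Space → ℂ} (hu : Measurable u)
    {χ : Config (n + 1) → ℂ} (hχ : Continuous χ) :
    Measurable fun Y : Config n =>
      ((‖∫ x, conj (u x) * χ (Matrix.vecCons x Y)‖₊ : ℝ≥0∞)) ^ 2 := by
  have h : StronglyMeasurable (Function.uncurry fun (Y : Config n) (x : Space) =>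
      conj (u x) * χ (Matrix.vecCons x Y)) := by
    refine Measurable.stronglyMeasurable ?_
    exact (Complex.continuous_conj.measurable.comp (hu.comp measurable_snd)).mul
      (hχ.measurable.comp (continuous_snd.matrixVecCons continuous_fst).measurable)
  have h2 : StronglyMeasurable fun Y : Config n => ∫ x, conj (u x) * χ (Matrix.vecCons x Y) :=
    h.integral_prod_right'
  exact (h2.measurable.nnnorm.coe_nnreal_ennreal).pow_const _

/-- parallelogram law for the occupation of a bounded measurable mode in superpositions of two trial states. -/
private theorem mt_occupation_add_add_sub {u : Space → ℂ} (hu : Measurable u) {C : ℝ}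
    (hC : ∀ x, ‖u x‖ ≤ C) (Ψ Φ : TrialState (n + 1) L) (a b : ℂ) :
    occupation (n + 1) u (fun X => a * Ψ.ψ X + b * Φ.ψ X) +
      occupation (n + 1) u (fun X => a * Ψ.ψ X - b * Φ.ψ X) =
    2 * occupation (n + 1) u (fun X => a * Ψ.ψ X) +
      2 * occupation (n + 1) u (fun X => b * Φ.ψ X) := by
  have hiΨ := fun Y => mt_integrable_pairing hu hC Ψ Y a
  have hiΦ := fun Y => mt_integrable_pairing hu hC Φ Y b
  have hcΨ : Continuous fun X => a * Ψ.ψ X := continuous_const.mul Ψ.contDiff.continuous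
  have hcΦ : Continuous fun X => b * Φ.ψ X := continuous_const.mul Φ.contDiff.continuous
  have hpt : ∀ Y : Config n,
      (∫ x, conj (u x) * (a * Ψ.ψ (Matrix.vecCons x Y) + b * Φ.ψ (Matrix.vecCons x Y))) =
        (∫ x, conj (u x) * (a * Ψ.ψ (Matrix.vecCons x Y))) +
          ∫ x, conj (u x) * (b * Φ.ψ (Matrix.vecCons x Y)) ∧
      (∫ x, conj (u x) * (a * Ψ.ψ (Matrix.vecCons x Y) - b * Φ.ψ (Matrix.vecCons x Y))) =
        (∫ x, conj (u x) * (a * Ψ.ψ (Matrix.vecCons x Y))) -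
          ∫ x, conj (u x) * (b * Φ.ψ (Matrix.vecCons x Y)) := by
    intro Y
    simp only [mul_add, mul_sub]
    exact ⟨integral_add (hiΨ Y) (hiΦ Y), integral_sub (hiΨ Y) (hiΦ Y)⟩
  have key : (∫⁻ Y : Config n, ((‖∫ x, conj (u x) *
        (a * Ψ.ψ (Matrix.vecCons x Y) + b * Φ.ψ (Matrix.vecCons x Y))‖₊ : ℝ≥0∞)) ^ 2) +
      (∫⁻ Y : Config n, ((‖∫ x, conj (u x) *
        (a * Ψ.ψ (Matrix.vecCons x Y) - b * Φ.ψ (Matrix.vecCons x Y))‖₊ : ℝ≥0∞)) ^ 2) =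
      2 * (∫⁻ Y : Config n, ((‖∫ x, conj (u x) * (a * Ψ.ψ (Matrix.vecCons x Y))‖₊ : ℝ≥0∞)) ^ 2) +
      2 * (∫⁻ Y : Config n, ((‖∫ x, conj (u x) * (b * Φ.ψ (Matrix.vecCons x Y))‖₊ : ℝ≥0∞)) ^ 2) := by
    rw [← lintegral_add_left (mt_measurable_pairing_sq hu (χ := fun X => a * Ψ.ψ X + b * Φ.ψ X)
        (hcΨ.add hcΦ)),
      ← lintegral_const_mul _ (mt_measurable_pairing_sq hu hcΨ),
      ← lintegral_const_mul _ (mt_measurable_pairing_sq hu hcΦ),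
      ← lintegral_add_left ((mt_measurable_pairing_sq hu hcΨ).const_mul 2)]
    exact lintegral_congr fun Y => by
      rw [(hpt Y).1, (hpt Y).2, mt_sq_nnnorm_add_add_sub, mul_add]
  simp only [occupation]
  calc _ = ((n : ℝ≥0∞) + 1) * ((∫⁻ Y : Config n, ((‖∫ x, conj (u x) *
        (a * Ψ.ψ (Matrix.vecCons x Y) + b * Φ.ψ (Matrix.vecCons x Y))‖₊ : ℝ≥0∞)) ^ 2) +
      (∫⁻ Y : Config n, ((‖∫ x, conj (u x) *
        (a * Ψ.ψ (Matrix.vecCons x Y) - b * Φ.ψ (Matrix.vecCons x Y))‖₊ : ℝ≥0∞)) ^ 2)) := by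
        rw [mul_add]
    _ = _ := by rw [key]; ring

/-- the pair-loss functional of level `k` (written out) scales like `|c|²`. -/
theorem pairLoss_const_mul (ℓ : ℝ) (k : ℕ) (c : ℂ) (χ : Config N → ℂ) :
    (16 : ℝ≥0∞)⁻¹ * ∑ q : SubIdx (2 ^ k), ∑ q' ∈ Finset.univ.filter
        (fun q' : SubIdx (2 ^ k) => q ≠ q' ∧ ∀ j : Fin 3, (q j : ℕ) / 2 = (q' j : ℕ) / 2),
        occupation N (fun x => subMode ℓ q x - subMode ℓ q' x) (fun X => c * χ X) =
    ((‖c‖₊ : ℝ≥0∞)) ^ 2 * ((16 : ℝ≥0∞)⁻¹ * ∑ q : SubIdx (2 ^ k), ∑ q' ∈ Finset.univ.filter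
        (fun q' : SubIdx (2 ^ k) => q ≠ q' ∧ ∀ j : Fin 3, (q j : ℕ) / 2 = (q' j : ℕ) / 2),
        occupation N (fun x => subMode ℓ q x - subMode ℓ q' x) χ) := by
  simp only [mt_occupation_const_mul, ← Finset.mul_sum]
  ring

/-- the dipole mode `u_c − u_{c'}` is measurable and bounded. -/
private theorem mt_dipMode_measurable_bounded (ℓ : ℝ) {k : ℕ} (c c' : SubIdx k) :
    Measurable (fun x => subMode ℓ c x - subMode ℓ c' x) ∧
      ∀ x, ‖subMode ℓ c x - subMode ℓ c' x‖ ≤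
        ‖((Real.sqrt (ℓ ^ 3))⁻¹ : ℂ)‖ + ‖((Real.sqrt (ℓ ^ 3))⁻¹ : ℂ)‖ := by
  have hm : ∀ q : SubIdx k, Measurable (subMode ℓ q) := fun q => by
    rw [subMode_eq_indicator]
    exact measurable_const.indicator (measurableSet_subCell ℓ q)
  refine ⟨(hm c).sub (hm c'), fun x => (norm_sub_le _ _).trans (add_le_add ?_ ?_)⟩ <;>
  · rw [subMode_eq_indicator]
    exact norm_indicator_le_norm_self _ _

/-- parallelogram law for the pair-loss functional in superpositions of two trial states. -/
theorem pairLoss_add_add_sub (ℓ : ℝ) (k : ℕ) (Ψ Φ : TrialState (n + 1) L) (a b : ℂ) :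
    (16 : ℝ≥0∞)⁻¹ * ∑ q : SubIdx (2 ^ k), ∑ q' ∈ Finset.univ.filter
        (fun q' : SubIdx (2 ^ k) => q ≠ q' ∧ ∀ j : Fin 3, (q j : ℕ) / 2 = (q' j : ℕ) / 2),
        occupation (n + 1) (fun x => subMode ℓ q x - subMode ℓ q' x) (fun X => a * Ψ.ψ X + b * Φ.ψ X) +
    (16 : ℝ≥0∞)⁻¹ * ∑ q : SubIdx (2 ^ k), ∑ q' ∈ Finset.univ.filter
        (fun q' : SubIdx (2 ^ k) => q ≠ q' ∧ ∀ j : Fin 3, (q j : ℕ) / 2 = (q' j : ℕ) / 2),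
        occupation (n + 1) (fun x => subMode ℓ q x - subMode ℓ q' x) (fun X => a * Ψ.ψ X - b * Φ.ψ X) =
    2 * ((16 : ℝ≥0∞)⁻¹ * ∑ q : SubIdx (2 ^ k), ∑ q' ∈ Finset.univ.filter
        (fun q' : SubIdx (2 ^ k) => q ≠ q' ∧ ∀ j : Fin 3, (q j : ℕ) / 2 = (q' j : ℕ) / 2),
        occupation (n + 1) (fun x => subMode ℓ q x - subMode ℓ q' x) (fun X => a * Ψ.ψ X)) +
    2 * ((16 : ℝ≥0∞)⁻¹ * ∑ q : SubIdx (2 ^ k), ∑ q' ∈ Finset.univ.filter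
        (fun q' : SubIdx (2 ^ k) => q ≠ q' ∧ ∀ j : Fin 3, (q j : ℕ) / 2 = (q' j : ℕ) / 2),
        occupation (n + 1) (fun x => subMode ℓ q x - subMode ℓ q' x) (fun X => b * Φ.ψ X)) := by
  have h : ∀ q q' : SubIdx (2 ^ k),
      occupation (n + 1) (fun x => subMode ℓ q x - subMode ℓ q' x) (fun X => a * Ψ.ψ X + b * Φ.ψ X) +
        occupation (n + 1) (fun x => subMode ℓ q x - subMode ℓ q' x) (fun X => a * Ψ.ψ X - b * Φ.ψ X) =
      2 * occupation (n + 1) (fun x => subMode ℓ q x - subMode ℓ q' x) (fun X => a * Ψ.ψ X) +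
        2 * occupation (n + 1) (fun x => subMode ℓ q x - subMode ℓ q' x) (fun X => b * Φ.ψ X) :=
    fun q q' => mt_occupation_add_add_sub (mt_dipMode_measurable_bounded ℓ q q').1
      (mt_dipMode_measurable_bounded ℓ q q').2 Ψ Φ a b
  rw [← mul_add, ← Finset.sum_add_distrib]
  simp_rw [← Finset.sum_add_distrib, h, Finset.sum_add_distrib, ← Finset.mul_sum]
  ring



end Summit.AtomisticToContinuum.BoseEinsteinCondensation.Theorems.GapWindowLadderMixingTransferAux

end
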